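import Summits.BirchSwinnertonDyer.BirchSwinnertonDyer.Theorems.PrintCf2SplitBadTwoLocSurjTwistedAssembly
import Summits.BirchSwinnertonDyer.BirchSwinnertonDyer.Theorems.PrintCf2SplitBadTwoNormAtVbarTwistedAssembly
import Summits.BirchSwinnertonDyer.BirchSwinnertonDyer.Theorems.PrintCf2SplitBadTwoQuadraticSignRamification
import Summits.BirchSwinnertonDyer.BirchSwinnertonDyer.Theorems.PrintCf2SplitBadTwoCMPrimaryConjugationTransport
import Literature.NumberTheory.EllipticCurves.BSDSelmerParityDokchitserTowerProofs
import Literature.NumberTheory.EllipticCurves.KellerYin2024.CharacterModulePrufer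
import HarnessLib

/-!
# Crux `PrintCf2.SplitBadTwoRankOneOfFacts` (stmt-BirchSwinnertonDyer-20368), registered stub (REG₂) `stub_xRegular_two`, S3N-FACTFREE road R2,
# ROAD (b) FOR SIGN-TWISTED COEFFICIENTS: (i) THE CASE «`ε ≠ 1` ON `U ∩ D_v̄`» IS UNCONDITIONAL (the twisted `v̄`-reading `hB5T` of
# `LayerShapiro.locSurj_layers_twisted` holds by its NON-SPLIT ESCAPE at every `w′ ∣ v̄`); (ii) THE CHARACTER-MODULE INSTANCES AT `p = 2`
# (`A := ℚ₂/ℤ₂(θ)`, `θ² = 1`, `ε` = the sign of `θ`) in the currency of -w2 g14's socket `XRegPinned.stub_xRegular_two_of_locSurjLayers`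

Cell `bsd-print-cf2`, WIDTH seat `bsd-line-cf2-p1-w8` g5 (prover-bsd-line-cf2-p1-w8-g5-0); `--supports stmt-BirchSwinnertonDyer-20368`
(helper, Theses-free). HONEST FRAMING: nothing here closes the crux or a registered stub; BSD is not proved by any of this; no summit
statement is proved by this seat. No definition, no named fact, no `sorry`.

WHY. The twisted end-to-end theorem `LayerShapiro.locSurj_layers_twisted` (p710454) gives (LSₙ) for `A ≅ ℚ_p/ℤ_p(ε)` at every layer
`U = κ.layerSubgroup n` of the `ℤ_p`-line unramified outside `v̄`, GIVEN the twisted `v̄`-reading `hB5T`, whose conclusion at a place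
`w′ ∣ v̄` of the twisted layer field `F′` is a disjunction: `p^M ∣ ord_{w′}(b)` OR «some prime `𝔓 ∣ w′` of `\bar ℤ_K` is stabilised by an
`s ∈ U` with `ε s ≠ 1`». By the trichotomy of the sign on the decomposition group `D_v̄ = GreenbergSelmer.decomp v̄`:
(B1) `ε = 1` on `D_v̄` — the left disjunct (B5-T proper: -w4 g14 `dvd_log_valuation_of_dualShapiro_mem_twisted`, -w3 g14 FILE 5/6, in flight);
(B2) `ε ≠ 1` on `D_v̄` but `= 1` on `U ∩ D_v̄` — reduced to (B1) by the re-twist `θ ↦ θ·χ` (-w4 g14 `SignTwist.locSurj_charModule_of_unitChar_eq_on`);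
(B3) `ε ≠ 1` on `U ∩ D_v̄` — THIS FILE: the right disjunct holds at EVERY `w′ ∣ v̄` (-w4 g14's `NormAtVbar.exists_nonsplit_escape`: a prime
`𝔓 ∣ w′` exists by going up, `𝔓 = g•𝔓₀` with `𝔓₀` the prime of the chosen embedding whose stabiliser is `D_v̄`, and `g s g⁻¹ ∈ U` stabilises
`𝔓` with the same sign), so (LSₙ) is UNCONDITIONAL in case (B3).

WHAT.
* (the non-split escape itself — `∃ 𝔓 ∣ w′, ∃ s ∈ U, ε s ≠ 1 ∧ s • 𝔓 = 𝔓` at every `w′ ∣ v̄`, VERBATIM the right disjunct of `hB5T` — is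
  -w4 g14's `NormAtVbar.exists_nonsplit_escape`, p712275, imported.)
* **`locSurj_layers_twisted_of_sign_on_decomp`** — `LayerShapiro.locSurj_layers_twisted` with `hB5T` DISCHARGED in case (B3): (LSₙ) for a discrete
  `A ≅ ℚ_p/ℤ_p(ε)` at the layer `n`, given `∃ s ∈ κ.layerSubgroup n, s ∈ D_v̄ ∧ ε s ≠ 1`. Unconditional.
* `signHom_eq_of_iff` — two `ℤˣ`-valued characters with the same kernel are equal (the sign `ε` of p706294 is determined by `θ`).
* **`locSurj_layers_charModule_twisted`** (`p = 2`) — (LSₙ) for `A_θ = ℚ₂/ℤ₂(θ)`, `θ² = 1`, `ε` its sign (`ε σ = 1 ↔ unitChar θ σ = 1`), at the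
  layer `n` of a `ℤ₂`-line `κ` unramified outside `v̄` of an imaginary quadratic `K` with `2 = v v̄`, GIVEN `hB5T` (VERBATIM as in p710454): the
  binders `hall`, `Sε/hSε`, `hA`, `hAε`, `e` of `locSurj_layers_twisted` are discharged (`CMPrimes.eq_or_eq_of_two_mem`,
  `KummerUDict.finite_setOf_not_isUnramifiedAt_of_sq_eq_one`, `isOpen_stabilizer_cofree`, p706294, `charModuleEquiv`).
* **`locSurj_layers_charModule_of_apply_ne_one_on_decomp`** (`p = 2`) — case (B3) for `A_θ`, UNCONDITIONAL and `ε`-free: if some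
  `s ∈ κ.layerSubgroup n ∩ D_v̄` has `θ s ≠ 1`, then (LSₙ) holds for `A_θ` at the layer `n` — VERBATIM the `m`-th instance of the `hLS` body of
  `XRegPinned.stub_xRegular_two_of_locSurjLayers`.
presearch: decomposition groups of conjugate primes `D_{g𝔓} = g D_𝔓 g⁻¹`, transitivity on primes above `v` — [NeukirchANT1999, Ch. I §9 (9.1)–(9.6)];
finiteness of ramification of a finite-order character — [SerreAbelianLadic1968, Ch. I §2.1]; assembly of tree theorems, no new fact.
beyond-print theorem: no.

References: [NeukirchANT1999] Ch. I §9; [GreenbergVatsal2000] §2 Prop. 2.1; [GreenbergLNM1716] §4; [SerreAbelianLadic1968] Ch. I §2.1.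
-/

noncomputable section

open scoped Classical ContRepresentation Pointwise

set_option linter.dupNamespace false
set_option autoImplicit false

open CategoryTheory NumberField IsDedekindDomain Field ValuativeRel
open Literature.NumberTheory.EllipticCurves Literature.NumberTheory.EllipticCurves.GreenbergSelmer
open Literature.NumberTheory.EllipticCurves.GreenbergVatsal2000 Literature.NumberTheory.EllipticCurves.KellerYin2024
open Literature.NumberTheory.GaloisRepresentations Literature.NumberTheory.GaloisRepresentations.LocalWeilDatum
open Literature.NumberTheory.GaloisRepresentations.DiscreteGaloisModule (SelmerStructure mu MuCarrier TateDual tateDual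
  coindTateDualMor coindTateDualHom)
open Literature.NumberTheory.GaloisCohomology
open Literature.NumberTheory.IwasawaTheory
open Summit.BirchSwinnertonDyer.Rank1Residual.X11b.LocBridge

namespace Summit.BirchSwinnertonDyer.BirchSwinnertonDyer.Theorems.PrintCf2.LayerShapiro

variable {K : Type} [Field K] [NumberField K]

/-! ## §1. (LSₙ) for sign-twisted coefficients is UNCONDITIONAL in case (B3) -/

variable {p : ℕ} [Fact p.Prime]

/-- **(LSₙ) FOR `A ≅ ℚ_p/ℤ_p(ε)` AT THE LAYER `n`, CASE (B3): some `s ∈ κ.layerSubgroup n ∩ D_v̄` has `ε s ≠ 1`.** `LayerShapiro.locSurj_layers_twisted`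
with its one displayed hypothesis `hB5T` discharged through the non-split escape (-w4 g14 `NormAtVbar.exists_nonsplit_escape`, p712275) at
every place `w′ ∣ v̄` of every twisted layer field `F′`. Conclusion VERBATIM the `hLSn n` body of `UpperBaseLift.locSurj_of_layers`.
[cite: GreenbergVatsal2000, §2 Prop. 2.1] [cite: GreenbergLNM1716, §4 Props. 4.13–4.15] [cite: NeukirchANT1999, Ch. I §9 (9.1)] -/
theorem locSurj_layers_twisted_of_sign_on_decomp (hK : IsImaginaryQuadratic K) {v vbar : HeightOneSpectrum (𝓞 K)}
    (hv : ((p : ℕ) : 𝓞 K) ∈ v.asIdeal) (hvbar : ((p : ℕ) : 𝓞 K) ∈ vbar.asIdeal) (hne : vbar ≠ v)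
    (hall : ∀ w : HeightOneSpectrum (𝓞 K), ((p : ℕ) : 𝓞 K) ∈ w.asIdeal → w = v ∨ w = vbar)
    (κ : ZpExtension K p) (hκ : κ.IsUnramifiedOutside vbar)
    (ε : absoluteGaloisGroup K →* ℤˣ) (hε : IsOpen (ε.ker : Set (absoluteGaloisGroup K)))
    (Sε : Finset (HeightOneSpectrum (𝓞 K)))
    (hSε : ∀ w : HeightOneSpectrum (𝓞 K), w ∉ Sε → ((p : ℕ) : 𝓞 K) ∉ w.asIdeal → ∀ τ ∈ GreenbergSelmer.inertia w, ε τ = 1)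
    {A : Type} [AddCommGroup A] [DistribMulAction (absoluteGaloisGroup K) A] [TopologicalSpace A] [DiscreteTopology A]
    (hA : ∀ a : A, IsOpen {σ : absoluteGaloisGroup K | σ • a = a})
    (hAε : ∀ (σ : absoluteGaloisGroup K) (a : A), σ • a = ((ε σ : ℤˣ) : ℤ) • a) (e : A ≃+ QpModZp p) (n : ℕ)
    [Fintype (absoluteGaloisGroup K ⧸ κ.layerSubgroup n)]
    (h3 : ∃ s ∈ κ.layerSubgroup n, s ∈ decomp (K := K) vbar ∧ ε s ≠ 1) :
    ∀ (T : Finset (HeightOneSpectrum (𝓞 K))), (∀ w ∈ T, ((p : ℕ) : 𝓞 K) ∉ w.asIdeal ∨ w = vbar) →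
      ∀ τ : (w : HeightOneSpectrum (𝓞 K)) →
        DoubleCoset.Quotient (decomp (K := K) w : Set (absoluteGaloisGroup K)) (κ.layerSubgroup n : Set (absoluteGaloisGroup K)) →
          subgroupH1 (decompIn (κ.layerSubgroup n) w) A,
      ∃ z : subgroupH1 (κ.layerSubgroup n) A,
        (∀ w ∈ T, ∀ q : DoubleCoset.Quotient (decomp (K := K) w : Set (absoluteGaloisGroup K))
            (κ.layerSubgroup n : Set (absoluteGaloisGroup K)),
          resOfLe A (inertiaIn_le_decompIn (κ.layerSubgroup n) w)
            (resH1Hom (decompInToH (κ.layerSubgroup n) w) (AddMonoidHom.id A) (fun _ _ ↦ rfl)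
              (conjH1 (κ.layerSubgroup n) A q.out z) - τ w q) = 0) ∧
        (∀ w : HeightOneSpectrum (𝓞 K), w ∉ T → (((p : ℕ) : 𝓞 K) ∉ w.asIdeal ∨ w = vbar) →
          ∀ σ : absoluteGaloisGroup K, conjH1 (κ.layerSubgroup n) A σ z ∈
            GreenbergVatsal2000.unramifiedKer (κ.layerSubgroup n) A w) :=
  locSurj_layers_twisted hK hv hvbar hne hall κ hκ ε hε Sε hSε hA hAε e n (by
    intro F' _ _ _ _ _ _ _ M N _ _ _ _ _ N' _ _ _ _ _ hN hN' _ _ _ B hB _ ι' _ _ m₀ _ s hs hs1 φ _ β _ b _ w'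
    exact Or.inr (NormAtVbar.exists_nonsplit_escape F' (κ.layerSubgroup n) ε vbar h3 w'))

/-! ## §2. Character modules at `p = 2` -/

/-- Two `ℤˣ`-valued characters with the same kernel coincide (`ℤˣ = {±1}`). [folklore] -/
theorem signHom_eq_of_iff {G : Type*} [Group G] (ε ε' : G →* ℤˣ) (h : ∀ σ, ε σ = 1 ↔ ε' σ = 1) : ε = ε' := by
  ext σ : 1
  rcases Int.units_eq_one_or (ε σ) with h1 | h1 <;> rcases Int.units_eq_one_or (ε' σ) with h2 | h2
  · rw [h1, h2]
  · exact absurd ((h σ).1 h1) (by rw [h2]; decide)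
  · exact absurd ((h σ).2 h2) (by rw [h1]; decide)
  · rw [h1, h2]

omit [NumberField K] in
/-- The sign `ε` of a quadratic framed character `θ` (`ε σ = 1 ↔ unitChar θ σ = 1`) has open kernel and IS the `Γ_K`-action on
`A_θ = ℚ₂/ℤ₂(θ)` (p706294 `KummerUDict.exists_signHom_of_sq_eq_one` + uniqueness `signHom_eq_of_iff`). [cite: KellerYin2024, §1.1] -/
theorem isOpen_ker_and_smul_eq_of_sign (θ : FramedGaloisRep K (padicCoeffIntegers (∅ : Set (PadicAlgCl 2))) 1)
    (hθ : ∀ σ : absoluteGaloisGroup K, θ σ ^ 2 = 1)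
    (ε : absoluteGaloisGroup K →* ℤˣ) (hiff : ∀ σ, ε σ = 1 ↔ unitChar θ σ = 1) :
    IsOpen ((ε.ker : Subgroup (absoluteGaloisGroup K)) : Set (absoluteGaloisGroup K)) ∧
    ∀ (σ : absoluteGaloisGroup K) (a : charModule (∅ : Set (PadicAlgCl 2)) θ), σ • a = ((ε σ : ℤˣ) : ℤ) • a := by
  obtain ⟨ε', -, hiff', hopen, hsmul⟩ := KummerUDict.exists_signHom_of_sq_eq_one θ hθ
  obtain rfl : ε = ε' := signHom_eq_of_iff ε ε' fun σ ↦ (hiff σ).trans (hiff' σ).symm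
  exact ⟨hopen, hsmul⟩

/-- The sign of a quadratic framed character is `1` on the chosen inertia groups outside the finite set of ramified places
(`KummerUDict.finite_setOf_not_isUnramifiedAt_of_sq_eq_one`, `…forall_inertia_apply_eq_one_of_isUnramifiedAt`). [cite: SerreAbelianLadic1968, Ch. I §2.1] -/
theorem sign_inertia_eq_one_of_not_mem (θ : FramedGaloisRep K (padicCoeffIntegers (∅ : Set (PadicAlgCl 2))) 1)
    (hθ : ∀ σ : absoluteGaloisGroup K, θ σ ^ 2 = 1)
    (ε : absoluteGaloisGroup K →* ℤˣ) (hiff : ∀ σ, ε σ = 1 ↔ unitChar θ σ = 1) :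
    ∀ w : HeightOneSpectrum (𝓞 K), w ∉ (KummerUDict.finite_setOf_not_isUnramifiedAt_of_sq_eq_one θ hθ).toFinset →
      ((2 : ℕ) : 𝓞 K) ∉ w.asIdeal → ∀ τ ∈ GreenbergSelmer.inertia w, ε τ = 1 := by
  intro w hw _ τ hτ
  rw [Set.Finite.mem_toFinset, Set.mem_setOf_eq, not_not] at hw
  exact (hiff τ).2 ((KummerUDict.unitChar_eq_one_iff_apply_eq_one θ τ).2
    (KummerUDict.forall_inertia_apply_eq_one_of_isUnramifiedAt θ hw τ hτ))

/-- **(LSₙ) FOR `A_θ = ℚ₂/ℤ₂(θ)`, `θ² = 1`, SIGN `ε`, MODULO THE TWISTED `v̄`-READING `hB5T`** (VERBATIM the `hB5T` of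
`LayerShapiro.locSurj_layers_twisted`, p710454, at `p = 2`): `K` imaginary quadratic with `2 = v v̄`, `κ` a `ℤ₂`-line unramified outside `v̄`,
`ε σ = 1 ↔ unitChar θ σ = 1`. The (B1) socket for -w4 g14's `dvd_log_valuation_of_dualShapiro_mem_twisted` / -w3 g14's FILE 5–6.
[cite: GreenbergVatsal2000, §2 Prop. 2.1] [cite: GreenbergLNM1716, §4 Props. 4.13–4.15] [cite: KellerYin2024, §1.1] -/
theorem locSurj_layers_charModule_twisted (hK : IsImaginaryQuadratic K) {v vbar : HeightOneSpectrum (𝓞 K)}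
    (hv : ((2 : ℕ) : 𝓞 K) ∈ v.asIdeal) (hvbar : ((2 : ℕ) : 𝓞 K) ∈ vbar.asIdeal) (hne : vbar ≠ v)
    (κ : ZpExtension K 2) (hκ : κ.IsUnramifiedOutside vbar)
    (θ : FramedGaloisRep K (padicCoeffIntegers (∅ : Set (PadicAlgCl 2))) 1) (hθ : ∀ σ : absoluteGaloisGroup K, θ σ ^ 2 = 1)
    (ε : absoluteGaloisGroup K →* ℤˣ) (hiff : ∀ σ, ε σ = 1 ↔ unitChar θ σ = 1) (n : ℕ)
    [Fintype (absoluteGaloisGroup K ⧸ κ.layerSubgroup n)]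
    (hB5T : ∀ (F' : IntermediateField K (AlgebraicClosure K)) [FiniteDimensional K F'] [IsAbelianGalois K F'] [NumberField F']
      [(galFixing K F').Normal] (hU' : galFixing K F' ≤ κ.layerSubgroup n) (_ : ∀ u ∈ galFixing K F', ε u = 1)
      (_ : ∀ u ∈ κ.layerSubgroup n, ε u = 1 → u ∈ galFixing K F')
      (M : ℕ) {N : Type} [AddCommGroup N] [DistribMulAction (absoluteGaloisGroup K) N] [TopologicalSpace N]
        [DiscreteTopology N] [Finite N]
      {N' : Type} [AddCommGroup N'] [DistribMulAction (absoluteGaloisGroup K) N'] [TopologicalSpace N'] [DiscreteTopology N']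
      [Finite N']
      (hN : ∀ m : N, IsOpen {σ : absoluteGaloisGroup K | σ • m = m}) (hN' : ∀ m : N', IsOpen {σ : absoluteGaloisGroup K | σ • m = m})
      (_ : ∀ (σ : absoluteGaloisGroup K) (x : N), σ • x = ((ε σ : ℤˣ) : ℤ) • x) (_ : ∀ x : N, 2 ^ M • x = 0)
      (_ : ∀ x : N', 2 ^ M • x = 0)
      (B : N →+ N' →+ MuCarrier K (2 ^ M))
      (hB : ∀ (σ : absoluteGaloisGroup K) (m : N) (m' : N'), B (ofSMul N hN σ m) (ofSMul N' hN' σ m') = mu K (2 ^ M) σ (B m m'))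
      (_ : Function.Bijective fun m' : N' ↦ B.flip m')
      (ι' : N' →+ Additive (AlgebraicClosure K)ˣ) (_ : Function.Injective ι')
      (_ : ∀ (g : absoluteGaloisGroup K) (x : N'), Additive.toMul (ι' (g • x)) = (g • Additive.toMul (ι' x)) ^ ((ε g : ℤˣ) : ℤ))
      (m₀ : N) (_ : ∀ m' : N', Additive.toMul (ι' m') = muVal K (2 ^ M) (B m₀ m'))
      {s : absoluteGaloisGroup K ⧸ κ.layerSubgroup n → absoluteGaloisGroup K}
      (hs : ∀ y, (s y : absoluteGaloisGroup K ⧸ κ.layerSubgroup n) = y)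
      (hs1 : s ((1 : absoluteGaloisGroup K) : absoluteGaloisGroup K ⧸ κ.layerSubgroup n) = 1)
      (φ : contOneCocycles (discreteTopRep (κ.layerSubgroup n) N')),
      galoisCohomology.localization (((ofSMul N hN).coind (κ.layerSubgroup n) (κ.isOpen_layerSubgroup n)).tateDual (2 ^ M))
          (Sum.inr vbar) 1
          (cohomologyMap (coindTateDualMor (ofSMul N hN) (ofSMul N' hN') (κ.layerSubgroup n) B (κ.isOpen_layerSubgroup n) hB) 1
            (shapiroLift (ofSMul N' hN').toTopRep (κ.layerSubgroup n) (κ.isOpen_layerSubgroup n) hs hs1 (oneCocycleClass _ φ))) ∈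
        (LocalInvariants.canonical K (2 ^ M)).dualLocalCondition ((ofSMul N hN).coind (κ.layerSubgroup n) (κ.isOpen_layerSubgroup n))
          (Sum.inr vbar)
          (DiscreteGaloisModule.unramifiedSubgroup
            (GaloisRep.toLocal vbar ((ofSMul N hN).coind (κ.layerSubgroup n) (κ.isOpen_layerSubgroup n))) 1) →
      ∀ β : (AlgebraicClosure K)ˣ,
        (∀ u : galFixing K F', Additive.toMul (ι' (φ.1 ⟨u, hU' u.2⟩)) = (u : absoluteGaloisGroup K) • β / β) →
        ∀ b : F', ((b : F') : AlgebraicClosure K) = ((β ^ 2 ^ M : (AlgebraicClosure K)ˣ) : AlgebraicClosure K) →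
        ∀ w' : vbar.Extension (𝓞 F'),
          ((2 ^ M : ℕ) : ℤ) ∣ WithZero.log (w'.1.valuation F' b) ∨
          ∃ 𝔓 : Ideal (absIntegers (𝓞 K) K),
            𝔓.comap (ringOfIntegersToIntegralClosure (k := K) (Ω := AlgebraicClosure K) F') = w'.1.asIdeal ∧
            ∃ s ∈ κ.layerSubgroup n, ε s ≠ 1 ∧ s • 𝔓 = 𝔓) :
    ∀ (T : Finset (HeightOneSpectrum (𝓞 K))), (∀ w ∈ T, ((2 : ℕ) : 𝓞 K) ∉ w.asIdeal ∨ w = vbar) →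
      ∀ τ : (w : HeightOneSpectrum (𝓞 K)) →
        DoubleCoset.Quotient (decomp (K := K) w : Set (absoluteGaloisGroup K)) (κ.layerSubgroup n : Set (absoluteGaloisGroup K)) →
          subgroupH1 (decompIn (κ.layerSubgroup n) w) (charModule (∅ : Set (PadicAlgCl 2)) θ),
      ∃ z : subgroupH1 (κ.layerSubgroup n) (charModule (∅ : Set (PadicAlgCl 2)) θ),
        (∀ w ∈ T, ∀ q : DoubleCoset.Quotient (decomp (K := K) w : Set (absoluteGaloisGroup K))
            (κ.layerSubgroup n : Set (absoluteGaloisGroup K)),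
          resOfLe (charModule (∅ : Set (PadicAlgCl 2)) θ) (inertiaIn_le_decompIn (κ.layerSubgroup n) w)
            (resH1Hom (decompInToH (κ.layerSubgroup n) w) (AddMonoidHom.id (charModule (∅ : Set (PadicAlgCl 2)) θ)) (fun _ _ ↦ rfl)
              (conjH1 (κ.layerSubgroup n) (charModule (∅ : Set (PadicAlgCl 2)) θ) q.out z) - τ w q) = 0) ∧
        (∀ w : HeightOneSpectrum (𝓞 K), w ∉ T → (((2 : ℕ) : 𝓞 K) ∉ w.asIdeal ∨ w = vbar) →
          ∀ σ : absoluteGaloisGroup K, conjH1 (κ.layerSubgroup n) (charModule (∅ : Set (PadicAlgCl 2)) θ) σ z ∈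
            GreenbergVatsal2000.unramifiedKer (κ.layerSubgroup n) (charModule (∅ : Set (PadicAlgCl 2)) θ) w) := by
  obtain ⟨hopen, hsmul⟩ := isOpen_ker_and_smul_eq_of_sign θ hθ ε hiff
  exact locSurj_layers_twisted hK hv hvbar hne (fun _ hw ↦ CMPrimes.eq_or_eq_of_two_mem K hK.1 hv hvbar hne hw) κ hκ ε hopen
    _ (sign_inertia_eq_one_of_not_mem θ hθ ε hiff) (isOpen_stabilizer_cofree _ θ) hsmul (charModuleEquiv θ) n hB5T

/-- **(LSₙ) FOR `A_θ = ℚ₂/ℤ₂(θ)`, `θ² = 1`, CASE (B3): some `s ∈ κ.layerSubgroup n ∩ D_v̄` has `θ s ≠ 1` — UNCONDITIONAL, `ε`-free.**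
`K` imaginary quadratic with `2 = v v̄`, `κ` a `ℤ₂`-line unramified outside `v̄`. Conclusion VERBATIM the `m := n` instance of the `hLS` body of
-w2 g14's socket `XRegPinned.stub_xRegular_two_of_locSurjLayers`. [cite: GreenbergVatsal2000, §2 Prop. 2.1] [cite: GreenbergLNM1716, §4 Props. 4.13–4.15]
[cite: NeukirchANT1999, Ch. I §9 (9.1)] -/
theorem locSurj_layers_charModule_of_apply_ne_one_on_decomp (hK : IsImaginaryQuadratic K) {v vbar : HeightOneSpectrum (𝓞 K)}
    (hv : ((2 : ℕ) : 𝓞 K) ∈ v.asIdeal) (hvbar : ((2 : ℕ) : 𝓞 K) ∈ vbar.asIdeal) (hne : vbar ≠ v)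
    (κ : ZpExtension K 2) (hκ : κ.IsUnramifiedOutside vbar)
    (θ : FramedGaloisRep K (padicCoeffIntegers (∅ : Set (PadicAlgCl 2))) 1) (hθ : ∀ σ : absoluteGaloisGroup K, θ σ ^ 2 = 1) (n : ℕ)
    (h3 : ∃ s ∈ κ.layerSubgroup n, s ∈ decomp (K := K) vbar ∧ θ s ≠ 1) :
    ∀ (T : Finset (HeightOneSpectrum (𝓞 K))), (∀ w ∈ T, ((2 : ℕ) : 𝓞 K) ∉ w.asIdeal ∨ w = vbar) →
      ∀ τ : (w : HeightOneSpectrum (𝓞 K)) →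
        DoubleCoset.Quotient (decomp (K := K) w : Set (absoluteGaloisGroup K)) (κ.layerSubgroup n : Set (absoluteGaloisGroup K)) →
          subgroupH1 (decompIn (κ.layerSubgroup n) w) (charModule (∅ : Set (PadicAlgCl 2)) θ),
      ∃ z : subgroupH1 (κ.layerSubgroup n) (charModule (∅ : Set (PadicAlgCl 2)) θ),
        (∀ w ∈ T, ∀ q : DoubleCoset.Quotient (decomp (K := K) w : Set (absoluteGaloisGroup K))
            (κ.layerSubgroup n : Set (absoluteGaloisGroup K)),
          resOfLe (charModule (∅ : Set (PadicAlgCl 2)) θ) (inertiaIn_le_decompIn (κ.layerSubgroup n) w)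
            (resH1Hom (decompInToH (κ.layerSubgroup n) w) (AddMonoidHom.id (charModule (∅ : Set (PadicAlgCl 2)) θ)) (fun _ _ ↦ rfl)
              (conjH1 (κ.layerSubgroup n) (charModule (∅ : Set (PadicAlgCl 2)) θ) q.out z) - τ w q) = 0) ∧
        (∀ w : HeightOneSpectrum (𝓞 K), w ∉ T → (((2 : ℕ) : 𝓞 K) ∉ w.asIdeal ∨ w = vbar) →
          ∀ σ : absoluteGaloisGroup K, conjH1 (κ.layerSubgroup n) (charModule (∅ : Set (PadicAlgCl 2)) θ) σ z ∈
            GreenbergVatsal2000.unramifiedKer (κ.layerSubgroup n) (charModule (∅ : Set (PadicAlgCl 2)) θ) w) := by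
  obtain ⟨ε, -, hiff, hopen, hsmul⟩ := KummerUDict.exists_signHom_of_sq_eq_one θ hθ
  haveI := ZpExtension.finiteIndex_layerSubgroup κ n
  haveI : Fintype (absoluteGaloisGroup K ⧸ κ.layerSubgroup n) := Fintype.ofFinite _
  obtain ⟨s, hsU, hsD, hθs⟩ := h3
  have hεs : ε s ≠ 1 := fun h ↦ hθs ((KummerUDict.unitChar_eq_one_iff_apply_eq_one θ s).1 ((hiff s).1 h))
  exact locSurj_layers_twisted_of_sign_on_decomp hK hv hvbar hne (fun _ hw ↦ CMPrimes.eq_or_eq_of_two_mem K hK.1 hv hvbar hne hw) κ hκ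
    ε hopen _ (sign_inertia_eq_one_of_not_mem θ hθ ε hiff) (isOpen_stabilizer_cofree _ θ) hsmul (charModuleEquiv θ) n
    ⟨s, hsU, hsD, hεs⟩

end Summit.BirchSwinnertonDyer.BirchSwinnertonDyer.Theorems.PrintCf2.LayerShapiro
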